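import Summits.QuantumFields.BalabanUV.Beta.VertexSandwichTransport
import Literature.MathematicalPhysics.QuantumFieldTheory.Balaban1983to89.Beta.SecondOrderResponse

/-!
# `BalabanUV.Beta.SecondOrderTransport` — binder row D1, W-side (L4), piece (W-T): THE ORDER-2 TRANSPORT THEOREM in SHARP-LAW form —
# the four table reflection laws transport to an2's second-order carrier `W2OfK` / `W2SymOfK` through any reflection-invariant packed kernel
# (β sub-cell, row BETA-an2 = BINDER-OWNERS row D1 OWNER, lineage an2 gen 17; the order-2 twin of an3's 29D `VertexSandwichTransport`)

HONEST FRAMING (cell charter, verbatim): «discharging BetaPertH makes Balaban's UV stability UNCONDITIONAL — a real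
constructive-QFT result; it is NOT the continuum limit and NOT the Clay problem.»  HONEST DEPENDENCY (verbatim): «continuum YM on T⁴ ⇐
BetaPertH ∧ nine spine estimates (0/9 proved); BetaPertH ⇐ (D1) ∧ (D4) ∧ CAP+tail; G-an2-4 gates asym, D1 and NE2/3/4.»  DERIVED cell leaf:
[folklore] kernel algebra (re-indexing of absolutely or unconditionally re-arrangeable sums); no statement of Bałaban's papers is typed
here, no `[cite:]` tag, no `def`, no `Prop` fact; it instantiates NO binder of the β-function wall.  NOT D1, NOT `BetaPertH`, NOT continuum,
NOT Clay.

## Why (design memo `SKELETON-D1-L4.v0` §3 (W-T); hR root `SpineRecursiveClosed.…_ctrC_closed_bcj` ⟸ EXACTLY the W-side sockets)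

The hR END for the recursive wall literal asks of the W-tables `W j μ y ν y′` a reflection law under `bref α` in BOTH coarse slots.  The
proposed W-literal (L4-D) is an2's Lagrangian-chart carrier `SecondOrderResponse.W2SymOfK G_j Lc S M S₂ M₂` over the wall's own step propagator.
This file proves the TRANSPORT half of that law, for an ARBITRARY packed kernel `K` with `refK (Φ N α) K = K` and arbitrary tables: if the
four tables obey SHARP reflection laws — `S κ (bref u) = ε_κ • refK (S♯ κ u)`, `M ρ (bref w) = ε_ρ • refK (M♯ ρ w)`,
`S₂ κ (bref u) κ′ (bref u′) = (ε_κ ε_κ′) • refK (S₂♯ κ u κ′ u′)`, `M₂ κ (bref u) ρ (bref w) = (ε_κ ε_ρ) • refK (M₂♯ κ u ρ w)` with ANY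
♯-tables (in the applications `S♯ = S + conjV 𝕄 (X ·)` etc.: a law WITH CONTACT is a sharp law whose ♯-table is table + contact) — then
**`W2OfK K N S M S₂ M₂ μ (bref α μ y) ν (bref α ν y′) = (ε_μ ε_ν) • refK (Φ N α) (W2OfK K N S♯ M♯ S₂♯ M₂♯ μ y ν y′)`** and the same for
`W2SymOfK`.  The REDUCTION of `W2OfK K N S♯ M♯ S₂♯ M₂♯ − W2OfK K N S M S₂ M₂` to an5's contact form `conjW 𝕄 V V′ X X′ X₂` (which needs the
relative-inverse rules `RelInv K 𝕄 E`) is piece (W-E)/(W-X) and is NOT in this file.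

## What is here (all [folklore]; `Φ = ResolventReflection.Φ N α`, `ε_κ = reflSign α κ`)

§1 `colH_refK_bref` / `colM_refK_bref` (columns of a RELABELLED kernel `refK Φ B` at the reflected coarse bond, ANY `B` — no invariance;
`colH_reflect` is the invariant case), `colM_reflect`.  §2 ONE-SLOT TRANSPORTS with NO summability hypothesis (re-indexing by the involutions
`bref α κ`, `tsum_mul_left`): `vertexOfK/vertexOfM/dM_refK_bref_sharp`, `vertexOfK/vertexOfM/dM_bref_sharp`; homogeneity in the kernel slot
(`colH_smul`, `colM_smul`, `vertexOfK/vertexOfM/dM_smul_kernel`) and in the table slot (`vertexOfK/vertexOfM_smul_family`).  §3 `K2OfK_bref_sharp`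
(THE DERIVATIVE OF THE INVERSE TRANSFORMS LIKE THE KERNEL, with the ♯-tables; `VertexReflectionContact.sandwich_refK` — the file's only analytic
input: `Spr K`, `Loc (dM K N S♯ M♯ ν y′)`), `resp_bref_sharp`.  §4 `vertex2OfK_bref_sharp`, `mixOfK_bref_sharp` (two nested one-slot transports).
§5 **`W2OfK_bref_sharp`**, **`W2SymOfK_bref_sharp`** — THE ORDER-2 TRANSPORT THEOREM; `loc_dM` (the `Loc` binder from table locality).

Provenance: β sub-cell, unit beta-an2 gen 17, 2026-08-20 (v1); over an3's `VertexSandwichTransport`/`VertexReflectionContact`/`E3LevelOneReflection`,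
an5's `ResolventReflection`/`KernelReflection`, an2's `SecondOrderResponse` — all BY NAME; no existing file touched.
-/

noncomputable section

open Finset
open scoped BigOperators
open Literature.MathematicalPhysics.QuantumFieldTheory
open Literature.MathematicalPhysics.QuantumFieldTheory.Balaban1983to89
open Literature.MathematicalPhysics.QuantumFieldTheory.Balaban1983to89.Beta
open ExpKernelCalculus (MKer comp Decays BiLoc VertexFamily)
open PolarizationSign (reflSign)
open KernelReflection (LegMap refK refK_apply)
open ResolventReflection (bref bref_bref mref mref_zsmul Φ Φ_r_inl Φ_r_inr Φ_s_inl Φ_s_inr reflSign_mul_self)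
open OneStepResolventKernel (Fib LocStencil wsum)
open OneStepKernelFamily (colH vertexOfK)
open InterLevelTransport (cwsum cwsum_apply)
open SecondOrderResponse (colM vertexOfM dM K2OfK vertex2OfK mixOfK W2OfK W2SymOfK W2OfK_apply vertexFamily_dM)
open Summit.QuantumFields.BalabanUV.Beta.TameKernelCalculus (Spr Loc Tame slice_tame)
open Summit.QuantumFields.BalabanUV.Beta.VertexReflectionContact (sandwich_refK refK_neg)
open Summit.QuantumFields.BalabanUV.Beta.VertexSandwichTransport (decays_of_spr)
open Summit.QuantumFields.BalabanUV.Beta.E3LevelOneReflection (refK_add refK_smul)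

namespace Summit.QuantumFields.BalabanUV.Beta.SecondOrderTransport

variable {d N : ℕ}

/-! ## §1 Columns of a relabelled kernel at the reflected coarse bond -/

/-- [folklore] **FIELD ROWS OF THE REFLECTED COLUMN OF A RELABELLED KERNEL**: for ANY packed `B`,
`colH (refK Φ B) N μ (bref α μ y) κ′ (bref α κ′ u) = ε_κ′ ε_μ · colH B N μ y κ′ u` (`mref (N•bref y) = N•bref (bref y) = N•y`). -/
theorem colH_refK_bref (B : MKer (d + 1) (Fib d)) (α μ : Fin (d + 1)) (y : Fin (d + 1) → ℤ) (κ' : Fin (d + 1)) (u : Fin (d + 1) → ℤ) :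
    colH (refK (Φ N α) B) N μ (bref α μ y) κ' (bref α κ' u) = reflSign α κ' * reflSign α μ * colH B N μ y κ' u := by
  simp only [colH, refK_apply, Φ_s_inl, Φ_s_inr, Φ_r_inl, Φ_r_inr, bref_bref, mref_zsmul]

/-- [folklore] **MULTIPLIER ROWS OF THE REFLECTED COLUMN OF A RELABELLED KERNEL**: for ANY packed `B`,
`colM (refK Φ B) N μ (bref α μ y) ρ (bref α ρ w) = ε_ρ ε_μ · colM B N μ y ρ w`. -/
theorem colM_refK_bref (B : MKer (d + 1) (Fib d)) (α μ : Fin (d + 1)) (y : Fin (d + 1) → ℤ) (ρ : Fin (d + 1)) (w : Fin (d + 1) → ℤ) :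
    colM (refK (Φ N α) B) N μ (bref α μ y) ρ (bref α ρ w) = reflSign α ρ * reflSign α μ * colM B N μ y ρ w := by
  simp only [colM, refK_apply, Φ_s_inr, Φ_r_inr, mref_zsmul, bref_bref]

/-- [folklore] For a reflection-INVARIANT kernel: the multiplier-row twin of `ResolventReflection.colH_reflect`. -/
theorem colM_reflect {K : MKer (d + 1) (Fib d)} {α : Fin (d + 1)} (hK : refK (Φ N α) K = K) (μ : Fin (d + 1)) (y : Fin (d + 1) → ℤ)
    (ρ : Fin (d + 1)) (w : Fin (d + 1) → ℤ) :
    colM K N μ (bref α μ y) ρ (bref α ρ w) = reflSign α ρ * reflSign α μ * colM K N μ y ρ w := by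
  have h := colM_refK_bref (N := N) K α μ y ρ w
  rwa [hK] at h

/-! ## §2 One-slot transports through a relabelled kernel (no summability), homogeneity -/

section OneSlot

variable {B : MKer (d + 1) (Fib d)} {α : Fin (d + 1)}

/-- [folklore] **TRANSPORT OF A SHARP TABLE LAW TO THE CHAIN-RULE VERTEX THROUGH A RELABELLED KERNEL** (no summability: re-indexing by the
involution `bref α κ′` and `tsum_mul_left`): if `F κ′ (bref α κ′ u′) = ε_κ′ • refK Φ (G κ′ u′)` then
`vertexOfK (refK Φ B) N F μ (bref α μ y) = ε_μ • refK Φ (vertexOfK B N G μ y)`. -/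
theorem vertexOfK_refK_bref_sharp {F G : Fin (d + 1) → (Fin (d + 1) → ℤ) → MKer (d + 1) (Fib d)}
    (hF : ∀ κ' u', F κ' (bref α κ' u') = reflSign α κ' • refK (Φ N α) (G κ' u')) (μ : Fin (d + 1)) (y : Fin (d + 1) → ℤ) :
    vertexOfK (refK (Φ N α) B) N F μ (bref α μ y) = reflSign α μ • refK (Φ N α) (vertexOfK B N G μ y) := by
  funext x z a b
  simp only [vertexOfK, OneStepResolventKernel.wsum, Pi.smul_apply, smul_eq_mul, refK_apply]
  have hterm : ∀ κ' : Fin (d + 1), ∑' u, colH (refK (Φ N α) B) N μ (bref α μ y) κ' u * F κ' u x z a b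
      = reflSign α μ * ((Φ N α).s a * (Φ N α).s b) *
          ∑' u, colH B N μ y κ' u * G κ' u ((Φ N α).r a x) ((Φ N α).r b z) a b := by
    intro κ'
    rw [← Equiv.tsum_eq (Function.Involutive.toPerm (bref α κ') (bref_bref α κ'))]
    simp only [Function.Involutive.coe_toPerm]
    rw [← tsum_mul_left]
    refine tsum_congr fun u => ?_
    rw [colH_refK_bref, hF κ' u]
    simp only [Pi.smul_apply, smul_eq_mul, refK_apply]
    have h1 := reflSign_mul_self α κ'
    calc reflSign α κ' * reflSign α μ * colH B N μ y κ' u *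
          (reflSign α κ' * ((Φ N α).s a * (Φ N α).s b * G κ' u ((Φ N α).r a x) ((Φ N α).r b z) a b))
        = (reflSign α κ' * reflSign α κ') * (reflSign α μ * ((Φ N α).s a * (Φ N α).s b) *
            (colH B N μ y κ' u * G κ' u ((Φ N α).r a x) ((Φ N α).r b z) a b)) := by ring
      _ = _ := by rw [h1, one_mul]
  calc ∑ κ', ∑' u, colH (refK (Φ N α) B) N μ (bref α μ y) κ' u * F κ' u x z a b
      = ∑ κ', reflSign α μ * ((Φ N α).s a * (Φ N α).s b) *
          ∑' u, colH B N μ y κ' u * G κ' u ((Φ N α).r a x) ((Φ N α).r b z) a b := Finset.sum_congr rfl fun κ' _ => hterm κ'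
    _ = reflSign α μ * ((Φ N α).s a * (Φ N α).s b *
          ∑ κ', ∑' u, colH B N μ y κ' u * G κ' u ((Φ N α).r a x) ((Φ N α).r b z) a b) := by
        rw [← Finset.mul_sum]; ring

/-- [folklore] **TRANSPORT OF A SHARP MULTIPLIER-TABLE LAW TO THE MULTIPLIER-COLUMN VERTEX THROUGH A RELABELLED KERNEL** (no
summability; re-indexing of the coarse sum by `bref α ρ`): if `M ρ (bref α ρ w) = ε_ρ • refK Φ (G ρ w)` then
`vertexOfM (refK Φ B) N M μ (bref α μ y) = ε_μ • refK Φ (vertexOfM B N G μ y)`. -/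
theorem vertexOfM_refK_bref_sharp [NeZero N] {M G : Fin (d + 1) → (Fin (d + 1) → ℤ) → MKer (d + 1) (Fib d)}
    (hM : ∀ ρ w, M ρ (bref α ρ w) = reflSign α ρ • refK (Φ N α) (G ρ w)) (μ : Fin (d + 1)) (y : Fin (d + 1) → ℤ) :
    vertexOfM (refK (Φ N α) B) N M μ (bref α μ y) = reflSign α μ • refK (Φ N α) (vertexOfM B N G μ y) := by
  funext x z a b
  simp only [vertexOfM, cwsum_apply, Pi.smul_apply, smul_eq_mul, refK_apply]
  have hterm : ∀ ρ : Fin (d + 1), ∑' w, colM (refK (Φ N α) B) N μ (bref α μ y) ρ w * M ρ w x z a b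
      = reflSign α μ * ((Φ N α).s a * (Φ N α).s b) *
          ∑' w, colM B N μ y ρ w * G ρ w ((Φ N α).r a x) ((Φ N α).r b z) a b := by
    intro ρ
    rw [← Equiv.tsum_eq (Function.Involutive.toPerm (bref α ρ) (bref_bref α ρ))]
    simp only [Function.Involutive.coe_toPerm]
    rw [← tsum_mul_left]
    refine tsum_congr fun w => ?_
    rw [colM_refK_bref, hM ρ w]
    simp only [Pi.smul_apply, smul_eq_mul, refK_apply]
    have h1 := reflSign_mul_self α ρ
    calc reflSign α ρ * reflSign α μ * colM B N μ y ρ w *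
          (reflSign α ρ * ((Φ N α).s a * (Φ N α).s b * G ρ w ((Φ N α).r a x) ((Φ N α).r b z) a b))
        = (reflSign α ρ * reflSign α ρ) * (reflSign α μ * ((Φ N α).s a * (Φ N α).s b) *
            (colM B N μ y ρ w * G ρ w ((Φ N α).r a x) ((Φ N α).r b z) a b)) := by ring
      _ = _ := by rw [h1, one_mul]
  calc ∑ ρ, ∑' w, colM (refK (Φ N α) B) N μ (bref α μ y) ρ w * M ρ w x z a b
      = ∑ ρ, reflSign α μ * ((Φ N α).s a * (Φ N α).s b) *
          ∑' w, colM B N μ y ρ w * G ρ w ((Φ N α).r a x) ((Φ N α).r b z) a b := Finset.sum_congr rfl fun ρ _ => hterm ρ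
    _ = reflSign α μ * ((Φ N α).s a * (Φ N α).s b *
          ∑ ρ, ∑' w, colM B N μ y ρ w * G ρ w ((Φ N α).r a x) ((Φ N α).r b z) a b) := by
        rw [← Finset.mul_sum]; ring

/-- [folklore] **TRANSPORT TO `dM = vertexOfK + vertexOfM`** through a relabelled kernel: both sharp laws at once. -/
theorem dM_refK_bref_sharp [NeZero N] {S Sg M Mg : Fin (d + 1) → (Fin (d + 1) → ℤ) → MKer (d + 1) (Fib d)}
    (hS : ∀ κ' u', S κ' (bref α κ' u') = reflSign α κ' • refK (Φ N α) (Sg κ' u'))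
    (hM : ∀ ρ w, M ρ (bref α ρ w) = reflSign α ρ • refK (Φ N α) (Mg ρ w)) (μ : Fin (d + 1)) (y : Fin (d + 1) → ℤ) :
    dM (refK (Φ N α) B) N S M μ (bref α μ y) = reflSign α μ • refK (Φ N α) (dM B N Sg Mg μ y) := by
  unfold SecondOrderResponse.dM
  rw [vertexOfK_refK_bref_sharp hS, vertexOfM_refK_bref_sharp hM, refK_add, smul_add]

end OneSlot

section Invariant

variable {K : MKer (d + 1) (Fib d)} {α : Fin (d + 1)}

/-- [folklore] `vertexOfK_refK_bref_sharp` through a reflection-INVARIANT kernel (`VertexReflectionContact.vertexOfK_bref_contact` is the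
case `G = F + C`, where summability is needed only to split the sum). -/
theorem vertexOfK_bref_sharp (hK : refK (Φ N α) K = K) {F G : Fin (d + 1) → (Fin (d + 1) → ℤ) → MKer (d + 1) (Fib d)}
    (hF : ∀ κ' u', F κ' (bref α κ' u') = reflSign α κ' • refK (Φ N α) (G κ' u')) (μ : Fin (d + 1)) (y : Fin (d + 1) → ℤ) :
    vertexOfK K N F μ (bref α μ y) = reflSign α μ • refK (Φ N α) (vertexOfK K N G μ y) := by
  have h := vertexOfK_refK_bref_sharp (B := K) (N := N) hF μ y
  rwa [hK] at h

/-- [folklore] `vertexOfM_refK_bref_sharp` through a reflection-invariant kernel. -/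
theorem vertexOfM_bref_sharp [NeZero N] (hK : refK (Φ N α) K = K) {M G : Fin (d + 1) → (Fin (d + 1) → ℤ) → MKer (d + 1) (Fib d)}
    (hM : ∀ ρ w, M ρ (bref α ρ w) = reflSign α ρ • refK (Φ N α) (G ρ w)) (μ : Fin (d + 1)) (y : Fin (d + 1) → ℤ) :
    vertexOfM K N M μ (bref α μ y) = reflSign α μ • refK (Φ N α) (vertexOfM K N G μ y) := by
  have h := vertexOfM_refK_bref_sharp (B := K) hM μ y
  rwa [hK] at h

/-- [folklore] `dM_refK_bref_sharp` through a reflection-invariant kernel: the first-order law `V (bref) = ε • refK (V♯)` of the Lagrangian-chart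
derivative `V = dM K N S M`, `V♯ = dM K N S♯ M♯`. -/
theorem dM_bref_sharp [NeZero N] (hK : refK (Φ N α) K = K) {S Sg M Mg : Fin (d + 1) → (Fin (d + 1) → ℤ) → MKer (d + 1) (Fib d)}
    (hS : ∀ κ' u', S κ' (bref α κ' u') = reflSign α κ' • refK (Φ N α) (Sg κ' u'))
    (hM : ∀ ρ w, M ρ (bref α ρ w) = reflSign α ρ • refK (Φ N α) (Mg ρ w)) (μ : Fin (d + 1)) (y : Fin (d + 1) → ℤ) :
    dM K N S M μ (bref α μ y) = reflSign α μ • refK (Φ N α) (dM K N Sg Mg μ y) := by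
  have h := dM_refK_bref_sharp (B := K) hS hM μ y
  rwa [hK] at h

end Invariant

section Homogeneity

/-- [folklore] `colH (c • B) = c · colH B`. -/
theorem colH_smul (c : ℝ) (B : MKer (d + 1) (Fib d)) (μ : Fin (d + 1)) (y : Fin (d + 1) → ℤ) (κ' : Fin (d + 1)) (u : Fin (d + 1) → ℤ) :
    colH (c • B) N μ y κ' u = c * colH B N μ y κ' u := by simp only [colH, Pi.smul_apply, smul_eq_mul]

/-- [folklore] `colM (c • B) = c · colM B`. -/
theorem colM_smul (c : ℝ) (B : MKer (d + 1) (Fib d)) (μ : Fin (d + 1)) (y : Fin (d + 1) → ℤ) (ρ : Fin (d + 1)) (w : Fin (d + 1) → ℤ) :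
    colM (c • B) N μ y ρ w = c * colM B N μ y ρ w := by simp only [colM, Pi.smul_apply, smul_eq_mul]

/-- [folklore] The KERNEL slot of `vertexOfK` is linear (no summability). -/
theorem vertexOfK_smul_kernel (c : ℝ) (B : MKer (d + 1) (Fib d)) (S : Fin (d + 1) → (Fin (d + 1) → ℤ) → MKer (d + 1) (Fib d))
    (μ : Fin (d + 1)) (y : Fin (d + 1) → ℤ) : vertexOfK (c • B) N S μ y = c • vertexOfK B N S μ y := by
  funext x z a b
  simp only [vertexOfK, OneStepResolventKernel.wsum, Pi.smul_apply, smul_eq_mul, colH_smul]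
  rw [Finset.mul_sum]
  refine Finset.sum_congr rfl fun κ' _ => ?_
  rw [← tsum_mul_left]
  exact tsum_congr fun u => by ring

/-- [folklore] The kernel slot of `vertexOfM` is linear (no summability). -/
theorem vertexOfM_smul_kernel [NeZero N] (c : ℝ) (B : MKer (d + 1) (Fib d))
    (M : Fin (d + 1) → (Fin (d + 1) → ℤ) → MKer (d + 1) (Fib d)) (μ : Fin (d + 1)) (y : Fin (d + 1) → ℤ) :
    vertexOfM (c • B) N M μ y = c • vertexOfM B N M μ y := by
  funext x z a b
  simp only [vertexOfM, cwsum_apply, Pi.smul_apply, smul_eq_mul, colM_smul]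
  rw [Finset.mul_sum]
  refine Finset.sum_congr rfl fun ρ _ => ?_
  rw [← tsum_mul_left]
  exact tsum_congr fun w => by ring

/-- [folklore] The kernel slot of `dM` is linear. -/
theorem dM_smul_kernel [NeZero N] (c : ℝ) (B : MKer (d + 1) (Fib d)) (S M : Fin (d + 1) → (Fin (d + 1) → ℤ) → MKer (d + 1) (Fib d))
    (μ : Fin (d + 1)) (y : Fin (d + 1) → ℤ) : dM (c • B) N S M μ y = c • dM B N S M μ y := by
  unfold SecondOrderResponse.dM
  rw [vertexOfK_smul_kernel, vertexOfM_smul_kernel, smul_add]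

/-- [folklore] The TABLE slot of `vertexOfK` is linear, family form (= `DecLiftAdjoint.vertexOfK_smul`; restated over this file's imports). -/
theorem vertexOfK_smul_family (K : MKer (d + 1) (Fib d)) (c : ℝ) (S : Fin (d + 1) → (Fin (d + 1) → ℤ) → MKer (d + 1) (Fib d))
    (μ : Fin (d + 1)) (y : Fin (d + 1) → ℤ) : vertexOfK K N (fun κ u => c • S κ u) μ y = c • vertexOfK K N S μ y := by
  funext x z a b
  simp only [vertexOfK, OneStepResolventKernel.wsum, Pi.smul_apply, smul_eq_mul]
  rw [Finset.mul_sum]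
  refine Finset.sum_congr rfl fun κ' _ => ?_
  rw [← tsum_mul_left]
  exact tsum_congr fun u => by ring

/-- [folklore] The table slot of `vertexOfM` is linear, family form. -/
theorem vertexOfM_smul_family [NeZero N] (K : MKer (d + 1) (Fib d)) (c : ℝ)
    (M : Fin (d + 1) → (Fin (d + 1) → ℤ) → MKer (d + 1) (Fib d)) (μ : Fin (d + 1)) (y : Fin (d + 1) → ℤ) :
    vertexOfM K N (fun ρ w => c • M ρ w) μ y = c • vertexOfM K N M μ y := by
  funext x z a b
  simp only [vertexOfM, cwsum_apply, Pi.smul_apply, smul_eq_mul]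
  rw [Finset.mul_sum]
  refine Finset.sum_congr rfl fun ρ _ => ?_
  rw [← tsum_mul_left]
  exact tsum_congr fun w => by ring

end Homogeneity

/-! ## §3 The derivative of the inverse and the second-response piece -/

section Inverse

variable [NeZero N] {K : MKer (d + 1) (Fib d)} {α : Fin (d + 1)}

omit [NeZero N] in
/-- [folklore] `K2OfK` as a negated sandwich (definitional). -/
theorem K2OfK_eq (K : MKer (d + 1) (Fib d)) (S M : Fin (d + 1) → (Fin (d + 1) → ℤ) → MKer (d + 1) (Fib d)) (ν : Fin (d + 1))
    (y' : Fin (d + 1) → ℤ) : K2OfK K N S M ν y' = -(comp (comp K (dM K N S M ν y')) K) := rfl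

/-- [folklore] **THE DERIVATIVE OF THE INVERSE TRANSFORMS LIKE THE KERNEL, WITH THE ♯-TABLES**: for `K` spread and reflection-invariant and
the two first-order sharp laws, `K2OfK K N S M ν (bref α ν y′) = ε_ν • refK Φ (K2OfK K N S♯ M♯ ν y′)` — the only analytic input is the
localisation of `dM K N S♯ M♯ ν y′` (slice summability of the sandwich, `VertexReflectionContact.sandwich_refK`). -/
theorem K2OfK_bref_sharp (hK : refK (Φ N α) K = K) (hKs : Spr K) {S Sg M Mg : Fin (d + 1) → (Fin (d + 1) → ℤ) → MKer (d + 1) (Fib d)}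
    (hS : ∀ κ' u', S κ' (bref α κ' u') = reflSign α κ' • refK (Φ N α) (Sg κ' u'))
    (hM : ∀ ρ w, M ρ (bref α ρ w) = reflSign α ρ • refK (Φ N α) (Mg ρ w)) (hD : ∀ ν y', Loc (dM K N Sg Mg ν y'))
    (ν : Fin (d + 1)) (y' : Fin (d + 1) → ℤ) :
    K2OfK K N S M ν (bref α ν y') = reflSign α ν • refK (Φ N α) (K2OfK K N Sg Mg ν y') := by
  have hKt : Tame K := hKs.tame
  have hDl := hD ν y'
  rw [K2OfK_eq, K2OfK_eq, dM_bref_sharp hK hS hM ν y', KernelReflection.comp_smul_right, KernelReflection.comp_smul_left,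
    sandwich_refK (Φ N α) hK (fun x z a f b => slice_tame hKt hDl.tame x z a f b)
      (fun x z a f b => slice_tame (hKs.comp_loc hDl).tame hKt x z a f b), refK_neg, smul_neg]

/-- [folklore] **THE SECOND-RESPONSE PIECE**: `dM (K2OfK K N S M ν (bref α ν y′)) N S M μ (bref α μ y) =
(ε_μ ε_ν) • refK Φ (dM (K2OfK K N S♯ M♯ ν y′) N S♯ M♯ μ y)` — the ♯-tables enter BOTH the differentiated inverse and the tables it reads. -/
theorem resp_bref_sharp (hK : refK (Φ N α) K = K) (hKs : Spr K) {S Sg M Mg : Fin (d + 1) → (Fin (d + 1) → ℤ) → MKer (d + 1) (Fib d)}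
    (hS : ∀ κ' u', S κ' (bref α κ' u') = reflSign α κ' • refK (Φ N α) (Sg κ' u'))
    (hM : ∀ ρ w, M ρ (bref α ρ w) = reflSign α ρ • refK (Φ N α) (Mg ρ w)) (hD : ∀ ν y', Loc (dM K N Sg Mg ν y'))
    (μ : Fin (d + 1)) (y : Fin (d + 1) → ℤ) (ν : Fin (d + 1)) (y' : Fin (d + 1) → ℤ) :
    dM (K2OfK K N S M ν (bref α ν y')) N S M μ (bref α μ y) =
      (reflSign α μ * reflSign α ν) • refK (Φ N α) (dM (K2OfK K N Sg Mg ν y') N Sg Mg μ y) := by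
  rw [K2OfK_bref_sharp hK hKs hS hM hD ν y', dM_smul_kernel, dM_refK_bref_sharp hS hM μ y, smul_smul,
    mul_comm (reflSign α ν) (reflSign α μ)]

end Inverse

/-! ## §4 The bi-vertex and the mixed bi-vertex -/

section BiVertex

variable {K : MKer (d + 1) (Fib d)} {α : Fin (d + 1)}

/-- [folklore] **THE BI-VERTEX TRANSPORTS WITH THE ♯-BI-TABLE** (two nested one-slot transports; no summability):
`vertex2OfK K N S₂ μ (bref α μ y) ν (bref α ν y′) = (ε_μ ε_ν) • refK Φ (vertex2OfK K N S₂♯ μ y ν y′)`. -/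
theorem vertex2OfK_bref_sharp (hK : refK (Φ N α) K = K)
    {S₂ S₂g : Fin (d + 1) → (Fin (d + 1) → ℤ) → Fin (d + 1) → (Fin (d + 1) → ℤ) → MKer (d + 1) (Fib d)}
    (hS₂ : ∀ κ u κ' u', S₂ κ (bref α κ u) κ' (bref α κ' u') = (reflSign α κ * reflSign α κ') • refK (Φ N α) (S₂g κ u κ' u'))
    (μ : Fin (d + 1)) (y : Fin (d + 1) → ℤ) (ν : Fin (d + 1)) (y' : Fin (d + 1) → ℤ) :
    vertex2OfK K N S₂ μ (bref α μ y) ν (bref α ν y') = (reflSign α μ * reflSign α ν) • refK (Φ N α) (vertex2OfK K N S₂g μ y ν y') := by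
  -- inner slot: for every outer index, the second-slot family obeys a sharp law with the scaled ♯-table
  have hin : ∀ κ u, vertexOfK K N (S₂ κ (bref α κ u)) ν (bref α ν y') =
      reflSign α κ • refK (Φ N α) (reflSign α ν • vertexOfK K N (S₂g κ u) ν y') := by
    intro κ u
    have hlaw : ∀ κ' u', S₂ κ (bref α κ u) κ' (bref α κ' u') = reflSign α κ' • refK (Φ N α) (reflSign α κ • S₂g κ u κ' u') := by
      intro κ' u'
      rw [hS₂, refK_smul, smul_smul, mul_comm (reflSign α κ') (reflSign α κ)]
    rw [vertexOfK_bref_sharp hK (F := S₂ κ (bref α κ u)) (G := fun κ' u' => reflSign α κ • S₂g κ u κ' u') hlaw ν y',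
      vertexOfK_smul_family, refK_smul, refK_smul, smul_smul, smul_smul, mul_comm (reflSign α ν) (reflSign α κ)]
  -- outer slot
  calc vertex2OfK K N S₂ μ (bref α μ y) ν (bref α ν y')
      = vertexOfK K N (fun κ u => vertexOfK K N (S₂ κ u) ν (bref α ν y')) μ (bref α μ y) := rfl
    _ = reflSign α μ • refK (Φ N α) (vertexOfK K N (fun κ u => reflSign α ν • vertexOfK K N (S₂g κ u) ν y') μ y) :=
        vertexOfK_bref_sharp hK hin μ y
    _ = (reflSign α μ * reflSign α ν) • refK (Φ N α) (vertex2OfK K N S₂g μ y ν y') := by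
        rw [vertexOfK_smul_family, refK_smul, smul_smul]; rfl

/-- [folklore] **THE MIXED BI-VERTEX TRANSPORTS WITH THE ♯-MIXED TABLE**:
`mixOfK K N M₂ μ (bref α μ y) ν (bref α ν y′) = (ε_μ ε_ν) • refK Φ (mixOfK K N M₂♯ μ y ν y′)`. -/
theorem mixOfK_bref_sharp [NeZero N] (hK : refK (Φ N α) K = K)
    {M₂ M₂g : Fin (d + 1) → (Fin (d + 1) → ℤ) → Fin (d + 1) → (Fin (d + 1) → ℤ) → MKer (d + 1) (Fib d)}
    (hM₂ : ∀ κ u ρ w, M₂ κ (bref α κ u) ρ (bref α ρ w) = (reflSign α κ * reflSign α ρ) • refK (Φ N α) (M₂g κ u ρ w))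
    (μ : Fin (d + 1)) (y : Fin (d + 1) → ℤ) (ν : Fin (d + 1)) (y' : Fin (d + 1) → ℤ) :
    mixOfK K N M₂ μ (bref α μ y) ν (bref α ν y') = (reflSign α μ * reflSign α ν) • refK (Φ N α) (mixOfK K N M₂g μ y ν y') := by
  have hin : ∀ κ u, vertexOfM K N (M₂ κ (bref α κ u)) ν (bref α ν y') =
      reflSign α κ • refK (Φ N α) (reflSign α ν • vertexOfM K N (M₂g κ u) ν y') := by
    intro κ u
    have hlaw : ∀ ρ w, M₂ κ (bref α κ u) ρ (bref α ρ w) = reflSign α ρ • refK (Φ N α) (reflSign α κ • M₂g κ u ρ w) := by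
      intro ρ w
      rw [hM₂, refK_smul, smul_smul, mul_comm (reflSign α ρ) (reflSign α κ)]
    rw [vertexOfM_bref_sharp hK (M := M₂ κ (bref α κ u)) (G := fun ρ w => reflSign α κ • M₂g κ u ρ w) hlaw ν y',
      vertexOfM_smul_family, refK_smul, refK_smul, smul_smul, smul_smul, mul_comm (reflSign α ν) (reflSign α κ)]
  calc mixOfK K N M₂ μ (bref α μ y) ν (bref α ν y')
      = vertexOfK K N (fun κ u => vertexOfM K N (M₂ κ u) ν (bref α ν y')) μ (bref α μ y) := rfl
    _ = reflSign α μ • refK (Φ N α) (vertexOfK K N (fun κ u => reflSign α ν • vertexOfM K N (M₂g κ u) ν y') μ y) :=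
        vertexOfK_bref_sharp hK hin μ y
    _ = (reflSign α μ * reflSign α ν) • refK (Φ N α) (mixOfK K N M₂g μ y ν y') := by
        rw [vertexOfK_smul_family, refK_smul, smul_smul]; rfl

end BiVertex

/-! ## §5 The order-2 transport theorem -/

section Transport

variable [NeZero N] {K : MKer (d + 1) (Fib d)} {α : Fin (d + 1)}

/-- [folklore] **THE ORDER-2 TRANSPORT THEOREM (sharp form)**: for a spread, reflection-invariant packed kernel `K` and tables obeying the four
sharp reflection laws (♯-tables arbitrary; `Loc (dM K N S♯ M♯ ν y′)` the only analytic binder),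
`W2OfK K N S M S₂ M₂ μ (bref α μ y) ν (bref α ν y′) = (ε_μ ε_ν) • refK (Φ N α) (W2OfK K N S♯ M♯ S₂♯ M₂♯ μ y ν y′)`. -/
theorem W2OfK_bref_sharp (hK : refK (Φ N α) K = K) (hKs : Spr K)
    {S Sg M Mg : Fin (d + 1) → (Fin (d + 1) → ℤ) → MKer (d + 1) (Fib d)}
    {S₂ S₂g M₂ M₂g : Fin (d + 1) → (Fin (d + 1) → ℤ) → Fin (d + 1) → (Fin (d + 1) → ℤ) → MKer (d + 1) (Fib d)}
    (hS : ∀ κ' u', S κ' (bref α κ' u') = reflSign α κ' • refK (Φ N α) (Sg κ' u'))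
    (hM : ∀ ρ w, M ρ (bref α ρ w) = reflSign α ρ • refK (Φ N α) (Mg ρ w))
    (hS₂ : ∀ κ u κ' u', S₂ κ (bref α κ u) κ' (bref α κ' u') = (reflSign α κ * reflSign α κ') • refK (Φ N α) (S₂g κ u κ' u'))
    (hM₂ : ∀ κ u ρ w, M₂ κ (bref α κ u) ρ (bref α ρ w) = (reflSign α κ * reflSign α ρ) • refK (Φ N α) (M₂g κ u ρ w))
    (hD : ∀ ν y', Loc (dM K N Sg Mg ν y'))
    (μ : Fin (d + 1)) (y : Fin (d + 1) → ℤ) (ν : Fin (d + 1)) (y' : Fin (d + 1) → ℤ) :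
    W2OfK K N S M S₂ M₂ μ (bref α μ y) ν (bref α ν y') =
      (reflSign α μ * reflSign α ν) • refK (Φ N α) (W2OfK K N Sg Mg S₂g M₂g μ y ν y') := by
  rw [W2OfK_apply, W2OfK_apply, vertex2OfK_bref_sharp hK hS₂, mixOfK_bref_sharp hK hM₂, mixOfK_bref_sharp hK hM₂,
    resp_bref_sharp hK hKs hS hM hD, mul_comm (reflSign α ν) (reflSign α μ), refK_add, refK_add, refK_add, smul_add, smul_add, smul_add]

/-- [folklore] **THE ORDER-2 TRANSPORT THEOREM FOR THE SWAP-SYMMETRISED CARRIER** `W2SymOfK` (the W-literal's shape): same hypotheses,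
`W2SymOfK K N S M S₂ M₂ μ (bref α μ y) ν (bref α ν y′) = (ε_μ ε_ν) • refK (Φ N α) (W2SymOfK K N S♯ M♯ S₂♯ M₂♯ μ y ν y′)`. -/
theorem W2SymOfK_bref_sharp (hK : refK (Φ N α) K = K) (hKs : Spr K)
    {S Sg M Mg : Fin (d + 1) → (Fin (d + 1) → ℤ) → MKer (d + 1) (Fib d)}
    {S₂ S₂g M₂ M₂g : Fin (d + 1) → (Fin (d + 1) → ℤ) → Fin (d + 1) → (Fin (d + 1) → ℤ) → MKer (d + 1) (Fib d)}
    (hS : ∀ κ' u', S κ' (bref α κ' u') = reflSign α κ' • refK (Φ N α) (Sg κ' u'))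
    (hM : ∀ ρ w, M ρ (bref α ρ w) = reflSign α ρ • refK (Φ N α) (Mg ρ w))
    (hS₂ : ∀ κ u κ' u', S₂ κ (bref α κ u) κ' (bref α κ' u') = (reflSign α κ * reflSign α κ') • refK (Φ N α) (S₂g κ u κ' u'))
    (hM₂ : ∀ κ u ρ w, M₂ κ (bref α κ u) ρ (bref α ρ w) = (reflSign α κ * reflSign α ρ) • refK (Φ N α) (M₂g κ u ρ w))
    (hD : ∀ ν y', Loc (dM K N Sg Mg ν y'))
    (μ : Fin (d + 1)) (y : Fin (d + 1) → ℤ) (ν : Fin (d + 1)) (y' : Fin (d + 1) → ℤ) :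
    W2SymOfK K N S M S₂ M₂ μ (bref α μ y) ν (bref α ν y') =
      (reflSign α μ * reflSign α ν) • refK (Φ N α) (W2SymOfK K N Sg Mg S₂g M₂g μ y ν y') := by
  unfold SecondOrderResponse.W2SymOfK
  rw [W2OfK_bref_sharp hK hKs hS hM hS₂ hM₂ hD μ y ν y', W2OfK_bref_sharp hK hKs hS hM hS₂ hM₂ hD ν y' μ y,
    mul_comm (reflSign α ν) (reflSign α μ), ← smul_add, ← refK_add, refK_smul, smul_comm]

/-- [folklore] **THE `Loc` BINDER FROM TABLE LOCALITY**: `dM K N S M ν y′` is localised for a decaying `K`, a local field table and a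
coarse-local multiplier table at a common positive rate not exceeding the kernel's (`SecondOrderResponse.vertexFamily_dM`). -/
theorem loc_dM {C δK : ℝ} (hKd : Decays K C δK) (hC : 0 ≤ C) {S M : Fin (d + 1) → (Fin (d + 1) → ℤ) → MKer (d + 1) (Fib d)}
    {Cs CM δ : ℝ} (hS : LocStencil S Cs δ) (hM : VertexFamily M N CM δ) (hδ : 0 < δ) (hδK : δ ≤ δK) (ν : Fin (d + 1))
    (y' : Fin (d + 1) → ℤ) : Loc (dM K N S M ν y') :=
  ⟨_, _, _, δ / 2, half_pos hδ, vertexFamily_dM hKd hC hS hM hδ hδK ν y'⟩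

end Transport

end Summit.QuantumFields.BalabanUV.Beta.SecondOrderTransport

end
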